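import Literature.AlgebraicGeometry.HodgeTheory.ProjectiveBundleTautologicalQuotient
import Literature.AlgebraicGeometry.Modules.RankOneTensorDualCancel
import Literature.AlgebraicGeometry.Modules.FrameTransition
import Literature.AlgebraicGeometry.Modules.RankOneCocycle
import Literature.AlgebraicGeometry.Modules.SerreTwistTrivial
import Literature.AlgebraicGeometry.Morphisms.CohOfVectorBundle
import Literature.AlgebraicGeometry.Motives.ChernClassesProofs
import HarnessLib

/-!
# The projective-bundle step of the splitting construction, reduced to GLOBALLY GENERATED bundles
# (Hartshorne II Prop. 7.11 / Lemma 7.9: `P(ℰ) ≅ P(ℰ ⊗ ℒ)`; Serre's theorem A) — the reduction theorems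

Family `hodge`, layer `Literature/AlgebraicGeometry/HodgeTheory`. THEOREMS ONLY (no definition, no instance, no
notation, no named fact, no `sorry`); the hypothesis of the main theorem is spelled out inline (it is named
`ProjectiveBundleOfGloballyGeneratedQuotient` in the sequel `HodgeTheory/ProjectiveBundleOfGloballyGeneratedQuotient`).

The tree's named fact `ProjectiveBundleTautologicalQuotient` (`HodgeTheory/ProjectiveBundleTautologicalQuotient`;
one level `P(F) → X` of Grothendieck's splitting construction: for `F` locally free of rank `≤ r + 1` on a
smooth projective complex `X`, a smooth projective `P`, a surjective `p : P ⟶ X` and a short exact sequence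
`0 → K → p^*F → L → 0` with `rank L ≤ 1`, `rank K ≤ r`) is here REDUCED to its special case for GLOBALLY
GENERATED bundles of CONSTANT rank (the hypothesis `h` of §3, = `ProjectiveBundleOfGloballyGeneratedQuotient` of the sequel): an epimorphism
`φ : 𝒪_X^J ↠ G` (`J` finite), `G` of rank `r + 1`, yields `P` smooth projective OF DIMENSION `dim X + r`,
`p` surjective and `0 → K → p^*G → L → 0` with `rank K = r`, `rank L = 1` — this is the input format of the
incidence construction `P(G) = V(u) ↪ X × Gr₁(ℤ^J)` over the tree's Grassmannian (`Motives/Grassmannian*`,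
`Modules/VanishingLocusOfHom`), which is NOT carried out here.

THE REDUCTION (`projectiveBundleTautologicalQuotient_of_forall_globallyGenerated`, §3), as in print:
* §1 on an irreducible scheme a module of rank `≤ s` has a constant rank `r' ≤ s`
  (`exists_hasRank_of_hasRankLE`: two frames over the non-empty intersection of two members of the cover
  have the same size, `Modules/FrameTransition.rank_eq_of_nontrivial`; Hartshorne II Ex. 5.7/5.8 context);
  the case `r' = 0` is settled by `P = X` and `0 → p^*F = p^*F → 0 → 0`;
* §2 Serre: on a projective `k`-scheme every vector bundle `F` becomes globally generated after a twist —
  `exists_epi_free_tensorObj_dual`: there are a line bundle `L₀ = 𝒪_X(-m)` and an epimorphism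
  `𝒪_X^J ↠ L₀^∨ ⊗ F`, `J` finite (Hartshorne II Thm. 5.17 / Cor. 5.18 in the tree's form
  `Modules/ResolutionPropertyProjective.SerreTwist.exists_epi_piPow`: `𝒪_X(-m)^{⊞(N+1)} ↠ F`, twisted by
  `L₀^∨ ⊗ –` with `L₀^∨ ⊗ 𝒪_X(-m)^{⊞(N+1)} ≅ 𝒪_X^{(N+1)}`, `Modules/RankOneTensorDualCancel`);
* §3 `P(F) := P(L₀^∨ ⊗ F)` (Hartshorne II Lemma 7.9 (b): `P(ℰ) ≅ P(ℰ ⊗ ℒ)` with `𝒪(1)` twisted): the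
  sequence `0 → K → p^*(L₀^∨ ⊗ F) → L → 0` twisted by the line bundle `p^*L₀` stays short exact with the
  same ranks and has middle term `p^*L₀ ⊗ p^*(L₀^∨ ⊗ F) ≅ p^*F`
  (`Modules/RankOneTensorDualCancel.exists_shortExact_tensorObj`, `nonempty_pullback_tensorObj_tensorObj_dual_iso`).

HONEST LEDGER. The hypothesis `h` (P(G) for globally generated `G`) is NOT proved here; the debt chain (all arrows
proved) reads `h ⟹ ProjectiveBundleTautologicalQuotient ⟹ FlagBundleSplitting ⟺ SplittingPrincipleBetti`.
Nothing here bears on any case of the Hodge conjecture.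

## References

* [Hartshorne1977] R. Hartshorne, *Algebraic Geometry* (1977), II §7 «The projective space bundle» Prop. 7.10,
  Prop. 7.11, Lemma 7.9 (p. 162); II Thm. 5.17, Cor. 5.18 (p. 121); II Ex. 5.1, Ex. 5.7.
* [Fulton1998] W. Fulton, *Intersection Theory*, 2nd ed. (1998), §3.2 (splitting construction), App. B.5.5.
* [Grothendieck1958] A. Grothendieck, *La théorie des classes de Chern*, Bull. SMF 86 (1958), §2.
* [StacksProject] The Stacks Project, Tag 0B8M, Tag 01CD.
-/

noncomputable section

open CategoryTheory CategoryTheory.Limits AlgebraicGeometry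
open ZeroObject
open Literature.AlgebraicGeometry.Motives Literature.AlgebraicGeometry.Modules
open Literature.AlgebraicGeometry.Morphisms Literature.AlgebraicGeometry.Morphisms.ProjCech

namespace Literature.AlgebraicGeometry.HodgeTheory

universe u

/-! ## §1 Constant rank on an irreducible scheme -/

section ConstantRank

variable {X : Scheme.{u}}

/-- **A finite locally free module of bounded rank on an IRREDUCIBLE scheme has a constant rank**: if `E`
has rank `≤ s` (local trivialisations of size `≤ s` over an open cover) then `E` has constant rank `r'` for
some `r' ≤ s`. Any two members of the cover containing points meet (irreducibility), their intersection
`V` has `Γ(X, V) ≠ 0`, and two frames of `E` over `V` have the same size (invariant basis number,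
`Modules/FrameTransition.rank_eq_of_nontrivial`). [cite: Hartshorne1977, II Ex. 5.7 (a) and II §5 p. 109
(rank of a locally free sheaf, constant on a connected scheme)] -/
theorem exists_hasRank_of_hasRankLE [IrreducibleSpace X] {E : X.Modules} {s : ℕ} (h : HasRankLE E s) :
    ∃ r' : ℕ, r' ≤ s ∧ HasRank E r' := by
  classical
  obtain ⟨q, hq, hr⟩ := h
  have hcov : ∀ x : X, ∃ a, x ∈ q.X a := fun x =>
    ((Opens.coversTop_iff _ q.X).mp q.coversTop).exists_mem x
  choose a ha using hcov
  haveI : ∀ i, Finite (q.generators i).I := fun i => (hr i).1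
  let F : Modules.FrameSystem E :=
    { U := fun x => q.X (a x)
      mem := ha
      I := fun x => (q.generators (a x)).I
      rank := fun x => Nat.card (q.generators (a x)).I
      enum := fun x => Finite.equivFin _
      frame := fun x => asIso (q.generators (a x)).π }
  obtain ⟨x₀⟩ := (inferInstance : Nonempty X)
  refine ⟨F.rank x₀, (hr (a x₀)).2, F.hasRank _ fun x => ?_⟩
  have hne : ((F.U x : Set X) ∩ (F.U x₀ : Set X)).Nonempty :=
    nonempty_preirreducible_inter (F.U x).isOpen (F.U x₀).isOpen ⟨x, F.mem x⟩ ⟨x₀, F.mem x₀⟩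
  haveI : Nonempty ↥(F.U x ⊓ F.U x₀) := by
    obtain ⟨y, hy⟩ := hne
    exact ⟨⟨y, hy⟩⟩
  exact Modules.rank_eq_of_nontrivial (F.frame x) (F.frame x₀) (F.enum x) (F.enum x₀)
    (homOfLE inf_le_left) (homOfLE inf_le_right)

end ConstantRank

/-! ## §2 Serre: every vector bundle on a projective scheme is globally generated after a twist -/

section Serre

variable {k : Type u} [Field k]

/-- `L^∨ ⊗ 𝒪_Z(-m)^{⊞(N+1)}` is free of finite rank for `L = 𝒪_Z(-m)` (induction on `N` along the iterated
biproduct `SerreTwist.Lpow`: `L^∨ ⊗ L ≅ 𝒪`, and `L^∨ ⊗ –` commutes with `⊞`).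
[cite: Hartshorne1977, II Cor. 5.18 (p. 121)] [cite: StacksProject, Tag 0B8K] -/
theorem exists_free_iso_tensorObj_dual_Lpow {r : ℕ} {Z : Scheme.{u}} (ι : Z ⟶ PP k r) (m : ℕ) :
    ∀ N : ℕ, ∃ (J : Type u) (_ : Finite J),
      Nonempty ((SheafOfModules.free J : Z.Modules) ≅
        tensorObj (dual (SerreTwist.serreTwist ι m)) (SerreTwist.Lpow ι m N))
  | 0 => ⟨PUnit, inferInstance, nonempty_free_punit_iso_tensorObj_dual
      (SerreTwist.isFiniteLocallyFree_serreTwist ι m) (SerreTwist.hasRank_serreTwist ι m)⟩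
  | N + 1 => by
    obtain ⟨J, hJ, ⟨e⟩⟩ := exists_free_iso_tensorObj_dual_Lpow ι m N
    obtain ⟨e₀⟩ := nonempty_free_punit_iso_tensorObj_dual
      (SerreTwist.isFiniteLocallyFree_serreTwist ι m) (SerreTwist.hasRank_serreTwist ι m)
    obtain ⟨e'⟩ := nonempty_free_sum_iso_tensorObj_biprod (dual (SerreTwist.serreTwist ι m))
      (SerreTwist.serreTwist ι m) (SerreTwist.Lpow ι m N) e₀ e
    exact ⟨PUnit ⊕ J, inferInstance, ⟨e'⟩⟩

/-- **Serre's theorem (Hartshorne II Thm. 5.17 / Cor. 5.18), twisted form**: for a vector bundle `F` on a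
projective `k`-scheme `X` there are a LINE BUNDLE `L₀` (namely `𝒪_X(-m)`, `m ≫ 0`) and an EPIMORPHISM
`𝒪_X^J ↠ L₀^∨ ⊗ F` with `J` finite — i.e. `F(m) = F ⊗ 𝒪_X(m)` is globally generated by finitely many global
sections. (The tree's `SerreTwist.exists_epi_piPow` gives `𝒪_X(-m)^{⊞(N+1)} ↠ F`; apply the right exact
functor `L₀^∨ ⊗ –`.) [cite: Hartshorne1977, II Thm. 5.17 and Cor. 5.18 (p. 121)] -/
theorem exists_epi_free_tensorObj_dual {X : SchemeOver k} (hX : IsProjectiveOver X) {F : X.left.Modules}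
    (hF : IsVectorBundle F) :
    ∃ L₀ : X.left.Modules, IsFiniteLocallyFree L₀ ∧ HasRank L₀ 1 ∧
      ∃ (J : Type u) (_ : Finite J) (ψ : (SheafOfModules.free J : X.left.Modules) ⟶ tensorObj (dual L₀) F),
        Epi ψ := by
  obtain ⟨n, ι, hι⟩ := hX
  let ι' : X.left ⟶ PP k n := ι.left
  haveI : IsClosedImmersion ι' := hι
  obtain ⟨m, N, g, hepi⟩ := SerreTwist.exists_epi_piPow ι' F hF.coh
  obtain ⟨J, hJ, ⟨e⟩⟩ := exists_free_iso_tensorObj_dual_Lpow ι' m N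
  haveI := hepi
  refine ⟨SerreTwist.serreTwist ι' m, SerreTwist.isFiniteLocallyFree_serreTwist ι' m,
    SerreTwist.hasRank_serreTwist ι' m, J, hJ,
    e.hom ≫ ((tensorBifunctor X.left).obj (dual (SerreTwist.serreTwist ι' m))).map (SerreTwist.piPow ι' F m g N),
    ?_⟩
  haveI hT : Epi (((tensorBifunctor X.left).obj (dual (SerreTwist.serreTwist ι' m))).map
      (SerreTwist.piPow ι' F m g N)) :=
    @epi_tensorBifunctor_obj_map _ (dual (SerreTwist.serreTwist ι' m)) _ _ (SerreTwist.piPow ι' F m g N) hepi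
  exact @epi_comp _ _ _ _ _ e.hom inferInstance _ hT

end Serre

/-! ## §3 The reduction -/

section Reduction

/-- The degenerate case of the projective-bundle step: for `F` of rank `0` take `P = X`, `p = 𝟙` and the
short exact sequence `0 → 𝟙^*F = 𝟙^*F → 0 → 0` (`𝟙^*F` has rank `0 ≤ r`, `0` has rank `≤ 1`).
[cite: Hartshorne1977, II §7 Prop. 7.11] -/
theorem exists_step_of_hasRank_zero {n : ℕ} {X : SchemeOver ℂ} (hX : IsSmoothProjective n X)
    {F : X.left.Modules} (hF : HasRank F 0) (r : ℕ) :
    ∃ (m : ℕ) (P : SchemeOver ℂ) (p : P ⟶ X), IsSmoothProjective m P ∧ Surjective p.left ∧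
      ∃ S : ShortComplex P.left.Modules, S.ShortExact ∧ HasRankLE S.X₁ r ∧ HasRankLE S.X₃ 1 ∧
        Nonempty (S.X₂ ≅ (Scheme.Modules.pullback p.left).obj F) := by
  refine ⟨n, X, 𝟙 X, hX, inferInstance, ?_⟩
  let M : X.left.Modules := (Scheme.Modules.pullback (𝟙 X : X ⟶ X).left).obj F
  let S : ShortComplex X.left.Modules := ShortComplex.mk (𝟙 M) (0 : M ⟶ 0) (by simp)
  have hS : S.ShortExact :=
    { exact := (S.exact_iff_epi rfl).mpr (by dsimp [S]; infer_instance)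
      mono_f := by dsimp [S]; infer_instance
      epi_g := (isZero_zero _).epi _ }
  refine ⟨S, hS, ?_, ?_, ⟨Iso.refl _⟩⟩
  · exact ((hasRank_pullback (𝟙 X : X ⟶ X).left hF).hasRankLE).mono (Nat.zero_le r)
  · exact (hasRankLE_zero_of_isZero (isZero_zero _)).mono zero_le_one

/-- **REDUCTION: the projective-bundle step for ALL vector bundles follows from the step for globally
generated ones** (hypothesis `h` = «P(G) with its tautological sequence for every epimorphism `𝒪_X^J ↠ G`,
`J` finite, `G` of rank `r + 1`, on every smooth projective complex `X`, with `dim P = dim X + r`»; named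
`ProjectiveBundleOfGloballyGeneratedQuotient` in the sequel).
For `F` of rank `≤ r + 1` on the smooth projective (irreducible) `X`: `F` has a constant rank `r' ≤ r + 1`
(§1); if `r' = 0` take `P = X`; otherwise Serre (§2) gives a line bundle `L₀` with `G := L₀^∨ ⊗ F`
globally generated of rank `r'`, the hypothesis gives `P → X` and `0 → K → p^*G → L → 0`, and twisting by
`p^*L₀` (exact, rank-preserving) gives `0 → p^*L₀ ⊗ K → p^*F → p^*L₀ ⊗ L → 0` since
`p^*L₀ ⊗ p^*(L₀^∨ ⊗ F) ≅ p^*F` — Hartshorne's `𝐏(ℰ) ≅ 𝐏(ℰ ⊗ ℒ)` with `𝒪(1)` twisted by `π^*ℒ`.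
[cite: Hartshorne1977, II §7 Lemma 7.9 (b) and Prop. 7.11; II Thm. 5.17] [cite: Fulton1998, §3.2] -/
theorem projectiveBundleTautologicalQuotient_of_forall_globallyGenerated
    (h : ∀ (n : ℕ) (X : SchemeOver ℂ), IsSmoothProjective n X →
      ∀ (J : Type) [Finite J] (G : X.left.Modules) (r : ℕ)
        (φ : (SheafOfModules.free J : X.left.Modules) ⟶ G), Epi φ → HasRank G (r + 1) →
        ∃ (P : SchemeOver ℂ) (p : P ⟶ X), IsSmoothProjective (n + r) P ∧ Surjective p.left ∧
          ∃ S : ShortComplex P.left.Modules, S.ShortExact ∧ HasRank S.X₁ r ∧ HasRank S.X₃ 1 ∧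
            Nonempty (S.X₂ ≅ (Scheme.Modules.pullback p.left).obj G)) :
    ProjectiveBundleTautologicalQuotient := by
  intro n X hX F r hF
  classical
  haveI : IrreducibleSpace X.left :=
    haveI := hX.geometricallyIrreducible
    GeometricallyIrreducible.irreducibleSpace_of_subsingleton X.hom
  obtain ⟨r', hr'le, hFr'⟩ := exists_hasRank_of_hasRankLE hF
  cases r' with
  | zero => exact exists_step_of_hasRank_zero hX hFr' r
  | succ s =>
    -- Serre: twist to a globally generated bundle `G = L₀^∨ ⊗ F` of rank `s + 1`
    obtain ⟨L₀, hL₀, hL₀1, J, hJ, ψ, hψ⟩ :=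
      exists_epi_free_tensorObj_dual hX.isProjectiveOver hF.isVectorBundle
    have hG : HasRank (tensorObj (dual L₀) F) (s + 1) := by
      simpa using hasRank_tensorObj (hasRank_dual hL₀1) hFr'
    obtain ⟨P, p, hP, hsurj, S, hS, h1, h3, ⟨e⟩⟩ := h n X hX J (tensorObj (dual L₀) F) s ψ hψ hG
    -- twist back by the line bundle `p^*L₀`
    have hpL : IsFiniteLocallyFree ((Scheme.Modules.pullback p.left).obj L₀) := hL₀.pullback p.left
    have hpL1 : HasRank ((Scheme.Modules.pullback p.left).obj L₀) 1 := hasRank_pullback p.left hL₀1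
    obtain ⟨e'⟩ := nonempty_pullback_tensorObj_tensorObj_dual_iso p.left hL₀ hL₀1 F
    obtain ⟨S', hS', h1', h3', ⟨e''⟩⟩ := exists_shortExact_tensorObj hpL hpL1 hS h1 h3 e
    refine ⟨n + s, P, p, hP, hsurj, S', hS', h1'.hasRankLE.mono (by omega), h3'.hasRankLE, ⟨e'' ≪≫ e'⟩⟩

end Reduction

end Literature.AlgebraicGeometry.HodgeTheory

end
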